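import Literature.NumberTheory.Automorphic.BrandtTraceFormulaEichlerSelberg
import Literature.NumberTheory.EllipticCurves.EichlerBasisTheoremOfTraceFormulas
import HarnessLib

/-!
# Takahashi's `rank_ℤ L = 1` granting the Eichler–Selberg trace formula and the mass formula

Topic `NumberTheory/EllipticCurves`; theorems only (no named fact, no `sorry`).  With Eichler's
trace formula for the Brandt matrices of a setup of level `(M, r)`, `Mr` squarefree, in
Eichler–Selberg form now a theorem (`Brandt.XiSetup.trace_matrix_eq_eichlerSelberg`, granting the
mass formula `brandtModule_massFormula`), the hypothesis `hB` of `traceIdentity_of_traceFormulas`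
is discharged: **`takahashi2001_brandtEigenLattice_rank_one` holds granting the Eichler–Selberg
trace formula in weight `2`, trivial character, at all levels (`HeckeTraceFormulaGL2Level N 1 2`)
and Eichler's mass formula** (`takahashi2001_brandtEigenLattice_rank_one_of_traceFormula_of_massFormula`).

## References

* T. Takahashi, *Degrees of parametrizations of elliptic curves by Shimura curves*, J. Number
  Theory 90 (2001), §2, [Takahashi2001].
* A. Pizer, *Theta series and modular forms of level `p²M`*, Compositio Math. 40 (1980),
  Thm. 2.25 (2.8) and Thm. 2.28, [Pizer1980].
-/

noncomputable section

namespace Literature.NumberTheory.EllipticCurves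

open Literature.NumberTheory.Automorphic Literature.NumberTheory.Automorphic.HeckeTraceFormulaGL2Level
open Brandt

/-- **Takahashi 2001, `rank_ℤ L = 1`, granting the Eichler–Selberg trace formula (weight `2`,
trivial character, all levels) and Eichler's mass formula:** the Brandt-module side of the
Eichler–Pizer trace identity `tr_{Mr} T(n) = tr B(n) - σ₁(n) + 2 tr_M T(n)` is now a theorem
(`XiSetup.trace_matrix_eq_eichlerSelberg`), so `traceIdentity_of_traceFormulas` and
`takahashi2001_brandtEigenLattice_rank_one_of_traceIdentity` apply. [cite: Takahashi2001, §2 (i), p. 3; Pizer1980, Thm. 2.25 (2.8) and Thm. 2.28] -/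
theorem takahashi2001_brandtEigenLattice_rank_one_of_traceFormula_of_massFormula
    (hTF : ∀ (N : ℕ) [NeZero N], HeckeTraceFormulaGL2Level N 1 2)
    (hmass : brandtModule_massFormula) :
    takahashi2001_brandtEigenLattice_rank_one :=
  takahashi2001_brandtEigenLattice_rank_one_of_traceIdentity fun _ _ _ _ hr hsq S _ =>
    traceIdentity_of_traceFormulas hr (not_dvd_of_squarefree_mul hr hsq) S (hTF _) (hTF _)
      (S.trace_matrix_eq_eichlerSelberg (Squarefree.of_mul_left hsq) hr (not_dvd_of_squarefree_mul hr hsq) hmass)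

end Literature.NumberTheory.EllipticCurves

end
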